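import Mathlib
import HarnessLib
import Summits.SmoothPoincare4.SmoothPoincare4.Theses.ZeroSurgeryExotic
import Literature.Topology.FourManifolds.BandSum
import Literature.Topology.FourManifolds.SliceRibbon
import Literature.Topology.FourManifolds.Knots

/-!
# Sketch — crux-ideate stmt-SmoothPoincare4-0364 (ZseThesis), ideator 2, round 1

First lemmas of the two idea cards (they must ELABORATE; the named-fact `def … : Prop`s are not
proved here).

* Card `montesinos-band-engine`: the engine outputs (i) a band presentation of the candidate slice
  friend `K` as a band sum of a split pair of unknots (fusion number one; the `f`-band case is the
  link version) certified by a free link group, and (ii) a certified common `0`-surgery with the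
  seed `K'`. `ribbon_of_bandSum_split_unknots` + `unlink_of_free_linkGroup` are the two classical
  facts that turn the engine's output into `K.IsRibbon`; `zseThesis_of_engineHit` is the glue.
* Card `property-r-refill`: `stageOne_not_spc4` (PROVED: stage one = HB-slice + non-slice seed
  refutes SPC4) and the glue `zseThesis_of_refill` over the abstract refill certificate.
* Card `refined-tier-bph-test`: the witness interface `SliceObstruction` (any `ℤ`-valued knot
  invariant vanishing on smoothly slice knots — Rasmussen `s_F`, Lipshitz–Sarkar `s^{Sq¹}`, the
  Dunfield–Lipshitz–Schütz components of `s̃_c`, Lobb–Wu `s₃`) and the glue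
  `zseThesis_of_witness`; the Transfer `C⁺` of the card (`zseThesis_of_ribbon_witness`).
-/

open scoped Manifold ContDiff
open ContinuousMap

namespace Summit.SmoothPoincare4.SmoothPoincare4.Cruxes.ZseThesis.Ideator2

open Literature.Topology.FourManifolds
open Summit.SmoothPoincare4.SmoothPoincare4.Theses.ZeroSurgeryExotic (ZseThesis)

/-- Local notation: `𝔼 n` is `EuclideanSpace ℝ (Fin n)`. -/
local notation "𝔼 " n:arg => EuclideanSpace ℝ (Fin n)

/-! ### Card A — montesinos-band-engine -/

/-- **Fusion-number-one ribbon discs** (named-fact shape; Gompf–Stipsicz 1999 §6.2, Kawauchi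
1996 Ch. 13): a band sum of a split pair of unknots bounds a ribbon disc (the two spanning discs
joined by the band, pushed into `B⁴`). -/
def ribbon_of_bandSum_split_unknots [SphereEmbedding.SmoothnessFacts] : Prop :=
  ∀ (K₁ K₂ K : Knot), K₁.IsUnknot → K₂.IsUnknot → Knot.IsSplit K₁ K₂ →
    Knot.IsBandSum K₁ K₂ K ∅ → K.IsRibbon

/-- **The unlink certificate** (named-fact shape; Papakyriakopoulos' loop/sphere theorems,
Kneser–Milnor: a 2-component link in `S³` whose group is free of rank 2 is the trivial link —
both components unknotted and split).  The engine certifies freeness by a Tietze transcript on the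
Regina/SnapPy presentation of `π₁` of the drilled-and-refilled triangulation. -/
def unlink_of_free_linkGroup [SphereEmbedding.SmoothnessFacts] : Prop :=
  ∀ (L : Link (Fin 2)) (x : L.complement),
    Nonempty (FundamentalGroup L.complement x ≃* FreeGroup (Fin 2)) →
      (L.component 0).IsUnknot ∧ (L.component 1).IsUnknot ∧
        Knot.IsSplit (L.component 0) (L.component 1)

/-- **Card A glue.** An engine hit — seed `K'` (certified non-slice), candidate friend `K` realised
as a band sum of the two components of a link with free group, and a certified common `0`-surgery
`Y` — closes the crux. -/
theorem zseThesis_of_engineHit [SphereEmbedding.SmoothnessFacts]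
    (hR : ribbon_of_bandSum_split_unknots) (hU : unlink_of_free_linkGroup)
    {K K' : Knot} {L : Link (Fin 2)} {x : L.complement}
    (hfree : Nonempty (FundamentalGroup L.complement x ≃* FreeGroup (Fin 2)))
    (hband : Knot.IsBandSum (L.component 0) (L.component 1) K ∅)
    {Y : Type} [TopologicalSpace Y] [ChartedSpace (𝔼 3) Y]
    (hK : IsIntegralSurgery (𝓡 3) Y K 0) (hK' : IsIntegralSurgery (𝓡 3) Y K' 0)
    (hns : ¬ K'.IsSmoothlySlice) : ZseThesis := by
  obtain ⟨h₀, h₁, hs⟩ := hU L x hfree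
  exact ⟨K, K', Y, _, _, hK, hK', (hR _ _ K h₀ h₁ hs hband).isSmoothlySlice, hns⟩

/-! ### Card B — refined-tier-bph-test -/

/-- **The witness interface.** A `B⁴`-slice obstruction: an integer-valued knot invariant that
vanishes on smoothly slice knots.  Printed instances: Rasmussen `s_F` (tree:
`Knot.HasRasmussenInvariant` / `eq_zero_of_isSmoothlySlice`), Lipshitz–Sarkar `s^{Sq¹}_±`, the
components `r^β, s^β` of the Dunfield–Lipshitz–Schütz tuples `s̃^β, s̃_c` (arXiv:2312.09114 §§5–7),
Lobb/Wu `s₃` and Lewark–Lobb's reduced `sl₃` homomorphisms (arXiv:1501.07138). -/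
structure SliceObstruction where
  /-- the invariant -/
  inv : Knot → ℤ
  /-- it vanishes on smoothly slice knots -/
  vanishes : ∀ K : Knot, K.IsSmoothlySlice → inv K = 0

/-- **Card B glue.** Any witness of the refined tier closes the crux: the statement of the crux
quantifies over NO particular obstruction. -/
theorem zseThesis_of_witness (Ω : SliceObstruction) {K K' : Knot}
    {Y : Type} [TopologicalSpace Y] [ChartedSpace (𝔼 3) Y]
    (hK : IsIntegralSurgery (𝓡 3) Y K 0) (hK' : IsIntegralSurgery (𝓡 3) Y K' 0)
    (hs : K.IsSmoothlySlice) (hω : Ω.inv K' ≠ 0) : ZseThesis :=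
  ⟨K, K', Y, _, _, hK, hK', hs, fun h => hω (Ω.vanishes K' h)⟩

/-- **Transfer `C⁺` of Card B** (Dunfield–Gong 2025 Thm 5.14, first three disjuncts, abstract
form): for a pair already certified as `0`-friends with `Ω(K') ≠ 0` (Table 11: `Ω = s̃_c`,
`K ∈ {16n68278, 17nh0010647, 18nh00098198}`), ONE ribbon certificate for `K` is the crux. -/
theorem zseThesis_of_ribbon_witness (Ω : SliceObstruction) {K K' : Knot}
    {Y : Type} [TopologicalSpace Y] [ChartedSpace (𝔼 3) Y]
    (hK : IsIntegralSurgery (𝓡 3) Y K 0) (hK' : IsIntegralSurgery (𝓡 3) Y K' 0)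
    (hω : Ω.inv K' ≠ 0) : K.IsRibbon → ZseThesis :=
  fun hr => zseThesis_of_witness Ω hK hK' hr.isSmoothlySlice hω

/-- **What the BPH test probes** (shape only).  Nakamura's stabilisation scheme (arXiv:2203.14270
Lemma 3.5 / Thm 3.13) kills a witness `Ω(K') ≠ 0` on a special RBG pair only through a SIGN LAW:
`Ω ≥ 0` on knots H-slice in some `#ⁿℂℙ²` and `Ω ≤ 0` on knots H-slice in some `#ⁿℂℙ²bar`, whence
`Ω = 0` on biprojectively H-slice knots (MP 2021 Def 2.4).  `BPHVanishing Ω bph` records that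
consequence for an abstract predicate `bph`; ONE biprojectively H-slice knot with `Ω ≠ 0` refutes
it and with it every proof along Nakamura's scheme for that `Ω`. -/
def BPHVanishing (Ω : SliceObstruction) (bph : Knot → Prop) : Prop :=
  ∀ K : Knot, bph K → Ω.inv K = 0

theorem not_bphVanishing_of_example (Ω : SliceObstruction) {bph : Knot → Prop} {K : Knot}
    (hK : bph K) (hω : Ω.inv K ≠ 0) : ¬ BPHVanishing Ω bph :=
  fun h => hω (h K hK)

/-! ### Card C — property-r-refill -/

/-- **Stage one of the refill already decides the summit** (PROVED from tree theorems — the FGMW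
lemma with Palais' disc theorem, `…_holds`): a knot slice in a homotopy 4-ball but not in `B⁴`
refutes SPC4. Stage one produces exactly such a knot: the certified-non-slice seed `S` itself,
slice in the homotopy ball `E_γ ∪ h(μ_S)` as soon as `S³₀(S) ∖ γ` has an integral `#²(S¹×S²)`
filling. (This is the route's support item `ZseHsliceNotSlice`, stmt-0520, in action.) -/
theorem stageOne_not_spc4 {S : Knot} (h₁ : S.IsHomotopyBallSlice) (h₂ : ¬ S.IsSmoothlySlice) :
    ¬ _root_.SmoothPoincare4 := by
  intro hS
  obtain ⟨M, i₁, i₂, i₃, i₄, i₅, i₆, ⟨e⟩, hE⟩ :=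
    Knot.exists_exotic_of_isHomotopyBallSlice_not_isSmoothlySlice_holds ⟨S, h₁, h₂⟩
  obtain ⟨d⟩ := hS M i₄ i₅ e
  exact hE.false d

/-- **What a stage-two refill certificate delivers** (named-fact shape; the Refill Lemma of the
card, whose proof is Laudenbach–Poénaru + one 1/2-handle cancellation + Gabai's Property R in
dual form + Waldhausen's genus-one splitting of `S¹×S²`): given the seed `S` with `Y` a
`0`-surgery on `S`, a refill certificate on `Y` produces a knot `K` (the core of the `S³`-filling
of `Y ∖ c`, i.e. the belt circle of the cancelling handle) which is smoothly slice and has `Y`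
as a `0`-surgery. The certificate itself is 3-dimensional (two fillings of the 2-cusped
`Y ∖ (γ ∪ c)` and one normal disc) and is abstracted here as `cert`. -/
def RefillDelivers (cert : ∀ (Y : Type) [TopologicalSpace Y] [ChartedSpace (𝔼 3) Y], Knot → Prop) :
    Prop :=
  ∀ (Y : Type) [TopologicalSpace Y] [ChartedSpace (𝔼 3) Y] (S : Knot),
    IsIntegralSurgery (𝓡 3) Y S 0 → cert Y S →
      ∃ K : Knot, K.IsSmoothlySlice ∧ IsIntegralSurgery (𝓡 3) Y K 0

/-- **Card C glue.** A refill certificate on the `0`-surgery of a certified-non-slice seed is the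
crux. -/
theorem zseThesis_of_refill {cert : ∀ (Y : Type) [TopologicalSpace Y] [ChartedSpace (𝔼 3) Y],
      Knot → Prop}
    (hcert : RefillDelivers cert) {Y : Type} [TopologicalSpace Y] [ChartedSpace (𝔼 3) Y] {S : Knot}
    (hS : IsIntegralSurgery (𝓡 3) Y S 0) (hc : cert Y S) (hns : ¬ S.IsSmoothlySlice) : ZseThesis := by
  obtain ⟨K, hK, hKY⟩ := hcert Y S hS hc
  exact ⟨K, S, Y, _, _, hKY, hS, hK, hns⟩

end Summit.SmoothPoincare4.SmoothPoincare4.Cruxes.ZseThesis.Ideator2
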